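import Summits.HodgeConjecture.HodgeCM.PerL34.DiscreteFundamentalDomain_1

/-! PORT of `HodgeCM/PerL34/DiscreteFundamentalDomain.lean` (HodgeCMPerL run 82) — part 2: continuation of `Summits.HodgeConjecture.HodgeCM.PerL34.DiscreteFundamentalDomain_1` (split at a top-level declaration boundary by port_pkg.py; scope re-opened below; declarations unchanged). -/

-- port_pkg: scope re-opened for this part (file-level context, then the namespace/section stack open at the cut)
set_option autoImplicit false
noncomputable section
open MeasureTheory Set Filter Topology
open scoped Pointwise
namespace HodgeCM.PerL34.DiscreteFD
section Group
variable {G : Type*} [Group G] [TopologicalSpace G]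
variable [IsTopologicalGroup G]
variable [SecondCountableTopology G] [MeasurableSpace G] [BorelSpace G]
variable [LocallyCompactSpace G]
/-- Measure form of the cocompact case, left action, `Γ` normal. -/
theorem exists_isFundamentalDomain_left_finite (Γ : Subgroup G) [DiscreteTopology Γ]
    [Γ.Normal] [CompactSpace (G ⧸ Γ)] (μ : Measure G) [IsFiniteMeasureOnCompacts μ] :
    ∃ 𝓕 : Set G, MeasurableSet 𝓕 ∧ IsFundamentalDomain Γ 𝓕 μ ∧
      IsCompact (closure 𝓕) ∧ μ 𝓕 < ⊤ := by
  obtain ⟨𝓕, h𝓕m, hc, h⟩ := exists_fundamentalDomain_left_relCompact Γ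
  exact ⟨𝓕, h𝓕m, isFundamentalDomain_of_existsUnique h𝓕m h μ, hc,
    (measure_mono subset_closure).trans_lt hc.measure_lt_top⟩

end Group

end HodgeCM.PerL34.DiscreteFD

end
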